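/-
COR-CM / cell hodgecm-mathlib (D-0151), item `HLiu418` (stmt-HodgeConjecture-24832), residual `stub_S34 : S34AtFace`, GS line,
node GS-7a (re-scoped edition, A-plan1 g7 KEY-pen ruling 2026-08-28 20:47:40Z «the E-pin exists in the tree, dropped at export»;
KEY `wake/KEY-hodgecm-mathlib-A-p07-gs7a-pieces-fieldrange-export.md` sha16 1729670ada781caa; writer A-p15 g5 by cession of
A-p07 g7 20:52:11Z).  THEOREMS ONLY: no definition, no instance, no named fact, nothing asserted; every landed file untouched.
FRAMING: HC_CM is proved only modulo the 7 printed citations until rung 0 closes; nothing here discharges a binder.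
-/
import Summits.HodgeConjecture.CorCM.B01.Transposition.HComp.PiecesOfRecord
import Literature.NumberTheory.Automorphic.IwahoriGL
import HarnessLib

/-!
# The pieces of the complex fibre of Deligne's canonical model, WITH THE FIELD PIN `(B q).E = τ(L)`

Re-export of ★ `Summits/HodgeConjecture/CorCM/B01/Transposition/HComp/PiecesOfRecord.lean` (`exists_pieces_of_components`,
`Record.exists_pieces`, `RecordSystem.exists_pieces`).  Those theorems derive, for Deligne's canonical-model record
`R : UnitaryCanonicalModel.Record L H τ T hT K` ([Deligne 1979] 2.2.5 in the tree's reading), the clause (F2c): the complex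
fibre `M_τ` is a finite coproduct of pieces `X_q`, each carrying a `UnitaryBallUniformisationDatum 2 (X_q)` whose COMPLEX
images are pinned (`(B q).Hℂ = H^τ`, `τ₁((B q).Γ) = τ(U(H)(L⁺) ∩ g_qKg_q⁻¹)`, `ι_q ∘ unif = [·, g_qK]`).  Inside their proof
(★ :166–:177) each piece datum comes from ★ `HComp.exists_pieceBallDatum` (algebraic half = ★ `PicardCode.ofHermitian`) WITH
the additional pin `(B q).E = τ.fieldRange` — the datum's CM subfield of `ℂ` IS `τ(L)` — which the ★ export drops at :193.

**E-OPACITY (A-plan1 g7, 2026-08-28).**  A consumer holding only the ★ statements sees `(B q).E : Subfield ℂ` as an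
∃-bound, hence opaque, field: the row-III-8′ fact `UnitaryBallUniformisationDatum.MR92Prop6Source (B q)` hands its detecting
line `W : Submodule (B q).E (Fin 3 → (B q).E)` over that opaque subfield, and no `L`-rational frame (`FacePinData`) can be read
off it.  With the pin `(B q).E = τ.fieldRange` the consumer chooses a ring isomorphism `e : L ≃+* ↥(B q).E` over `τ`
(`ballDatum_exists_ringEquiv_coe_eq_of_E_eq`), reads `(B q).H = H.map e` and `(B q).Γ = Γ_q.map (GL.map e)` (§4), pulls `W` back to an
`L`-line, and runs the tree's frame engine over `L`.

## Contents (namespace `Summit.HodgeConjecture.CorCM.HComp`)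
* §1 `exists_pieces_of_components_fieldRange` — ★ `exists_pieces_of_components` with `(B q).E = τ.fieldRange ∧` prepended
  (proof = the ★ proof, keeping the conjunct it dropped);
* §2 `Record.exists_pieces_fieldRange` — ★ `Record.exists_pieces`, same prepended conjunct;
* §3 `RecordSystem.exists_pieces_fieldRange` — ★ `RecordSystem.exists_pieces`, same prepended conjunct;
* §4 READ-OUTS over the pinned field, def-free and generic over `D : UnitaryBallUniformisationDatum p X`, `τ : L →+* ℂ` and an
  ARBITRARY `e : L ≃+* ↥D.E` with `(e x : ℂ) = τ x`: existence of such `e` from `D.E = τ.fieldRange`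
  (`ballDatum_exists_ringEquiv_coe_eq_of_E_eq`); `D.H = Hm.map e` from `D.Hℂ = Hm^τ` (`ballDatum_H_eq_map_ringEquiv_of_Hℂ_eq`);
  `D.Γ = Γ′.map (GL.map e)` from equality of the `GL(ℂ)`-images (`ballDatum_Γ_eq_map_ringEquiv_of_map_eq`, via ★
  `Literature.NumberTheory.Automorphic.generalLinearGroup_map_injective` of `IwahoriGL.lean`).  The conjugation compatibility
  `conjRingHom D.E (e x) = e (x̄)` and the complex read-out `(Hm.map e).map D.E.subtype = Hm.map τ` are NOT restated here: they
  are the subfield-code lemmas `CodeField.conjRingHom_ringEquiv_apply` / `CodeField.map_ringEquiv_map_subtype` of the GS-7b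
  transport file `Literature/NumberTheory/Automorphic/UnitaryGroupFieldRangeTransport.lean` (A-p02, same night; one writer per
  lemma), which with §4 feed the ★ transport lemmas `PicardCM.isCongruenceSubgroup_map` / `anisotropic_map_ringEquiv_iff` /
  `hermForm_map_ringEquiv` (`Literature/NumberTheory/Automorphic/PicardCMUniverse.lean`) — cited, not restated; the GS-7c consumer
  imports both files.

Statements of §§1–3 differ from the ★ ones ONLY by the prepended conjunct (token-for-token otherwise).  0 hypothesis binders
of Prop-valued named facts.

References: P. Deligne, *Variétés de Shimura*, Proc. Symp. Pure Math. 33.2 (1979), 2.1.2–2.1.4, 2.2.5; J. S. Milne,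
*Introduction to Shimura varieties* (2005, rev. 2017), Lemma 5.13 p. 57, Def. 12.10 p. 115; N. Bergeron, J. Millson,
C. Moeglin, Acta Math. 216 (2016), Introduction §1.1, Part 2 §§1.1–1.4.
-/

set_option autoImplicit false

noncomputable section

open scoped Matrix Topology ComplexOrder
open Set Function MulAction Matrix NumberField CategoryTheory CategoryTheory.Limits AlgebraicGeometry Opposite
open Literature.Geometry.ComplexHyperbolic
open Literature.Geometry.ComplexHyperbolic.BallModel (U21 Ball proj lift mat x₀)
open Literature.NumberTheory.Automorphic
open Literature.NumberTheory.Automorphic.UnitaryGroup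
open Literature.NumberTheory.Automorphic.ShimuraDissection (CosetSpace)
open Literature.AlgebraicGeometry.ShimuraVarieties (negCone hermForm UnitaryBallUniformisationDatum IsCongruenceSubgroup)
open Literature.AlgebraicGeometry.ShimuraVarieties.UnitaryCanonicalModel (Record RecordSystem)
open Literature.AlgebraicGeometry.Motives (SchemeOver ComplexPoints AlgPoints IsSmoothProjective IsProjectiveOver baseChangeHom)
open Literature.NumberTheory.Automorphic.Liu2021.AppendixC (C5.OpenCompactSubgroup C5.SmallLevel)

namespace Summit.HodgeConjecture.CorCM.HComp

variable (L : Type) [Field L] [NumberField L] [IsCMField L] (H : Matrix (Fin 3) (Fin 3) L)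
  (τ : L →+* ℂ) (T : GL (Fin 3) ℂ) (hT : formCongr (starRingEnd ℂ) T (H.map τ) = BallModel.J)
  (K : Subgroup (finAdelic (↥(maximalRealSubfield L)) L (IsCMField.complexConj L) 3 H))

/-! ## 1. From a component presentation of a complex model to the pieces shape, with the field pin -/

/-- **Pieces from components, with `(B q).E = τ(L)`.**  ★ `exists_pieces_of_components` (same hypotheses, token for token)
with ONE conjunct prepended to its conclusion: the CM subfield of each piece datum is `τ.fieldRange`.  The ★ proof obtains
exactly this from ★ `exists_pieceBallDatum` and drops it at export; here it is kept.
[cite: Deligne1979ShimuraVarieties, §2.1.2] [cite: Milne2005ShimuraVarieties, Lemma 5.13 p. 57]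
[cite: BergeronMillsonMoeglin2016Balls, Introduction §1.1 and Part 2 §§1.1–1.4] -/
theorem exists_pieces_of_components_fieldRange
    (hH : ∀ i j, cmConjRingHom L (H i j) = H j i)
    (hanis : ∀ v : Fin 3 → L, hermForm (cmConjRingHom L) H v v = 0 → v = 0)
    (hpos : ∀ τ' : L →+* ℂ, InfinitePlace.mk τ' ≠ InfinitePlace.mk τ → (H.map τ').PosDef)
    (hKc : IsCompact (K : Set (finAdelic (↥(maximalRealSubfield L)) L (IsCMField.complexConj L) 3 H)))
    (hKo : IsOpen (K : Set (finAdelic (↥(maximalRealSubfield L)) L (IsCMField.complexConj L) 3 H)))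
    (htf : ∀ g : finAdelic (↥(maximalRealSubfield L)) L (IsCMField.complexConj L) 3 H,
      ∀ γ ∈ arithmeticLevel (↥(maximalRealSubfield L)) L (IsCMField.complexConj L) 3 H
        (K.map (MulAut.conj g).toMonoidHom), IsOfFinOrder γ → γ = 1)
    {X : SchemeOver ℂ}
    (P : Ball → finAdelic (↥(maximalRealSubfield L)) L (IsCMField.complexConj L) 3 H → ComplexPoints X)
    (hol : ∀ a : finAdelic (↥(maximalRealSubfield L)) L (IsCMField.complexConj L) 3 H,
      ∃ u : (Fin 3 → ℂ) → ComplexPoints X,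
        (∀ x : Ball, u ((T : Matrix (Fin 3) (Fin 3) ℂ) *ᵥ lift x) = P x a) ∧
        (∀ v ∈ negCone (H.map τ), ∀ c : ℂ, c ≠ 0 → u (c • v) = u v) ∧
        ∀ (U : X.left.affineOpens) (f : X.left.presheaf.obj (op (U : X.left.Opens))),
          DifferentiableOn ℂ (fun v ↦ AlgPoints.evalOrZero (U : X.left.Opens) f (u v))
            (negCone (H.map τ) ∩ u ⁻¹' {Q | Q.pt ∈ (U : X.left.Opens)}))
    (g : orbitRel.Quotient (rational (↥(maximalRealSubfield L)) L (IsCMField.complexConj L) 3 H)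
          (CosetSpace (rationalToFinAdelic (↥(maximalRealSubfield L)) L (IsCMField.complexConj L) 3 H) K) →
        finAdelic (↥(maximalRealSubfield L)) L (IsCMField.complexConj L) 3 H)
    (E : orbitRel.Quotient (rational (↥(maximalRealSubfield L)) L (IsCMField.complexConj L) 3 H)
          (CosetSpace (rationalToFinAdelic (↥(maximalRealSubfield L)) L (IsCMField.complexConj L) 3 H) K) →
        SchemeOver ℂ)
    (ι : ∀ q, E q ⟶ X)
    (φ : ∀ q, ComplexPoints (E q) ≃ₜ
      orbitRel.Quotient
        (archImageU21 L H τ T hT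
          (arithmeticLevel (↥(maximalRealSubfield L)) L (IsCMField.complexConj L) 3 H
            (K.map (MulAut.conj (g q)).toMonoidHom)))
        Ball)
    (hE : ∀ q, IsSmoothProjective 2 (E q)) (hopen : ∀ q, IsOpenImmersion (ι q).left)
    (hφ : ∀ q (z : Ball), AlgPoints.map (L := ℂ) (ι q) ((φ q).symm (Quotient.mk'' z)) = P z (g q))
    (hcol : IsColimit (Cofan.mk X ι)) :
    ∃ (X' : orbitRel.Quotient (rational (↥(maximalRealSubfield L)) L (IsCMField.complexConj L) 3 H)
          (CosetSpace (rationalToFinAdelic (↥(maximalRealSubfield L)) L (IsCMField.complexConj L) 3 H) K) →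
        SchemeOver ℂ)
      (ι' : ∀ q, X' q ⟶ X)
      (_ : IsColimit (Cofan.mk X ι'))
      (B : ∀ q, UnitaryBallUniformisationDatum 2 (X' q)),
      ∀ q, (B q).E = τ.fieldRange ∧ (B q).Hℂ = H.map τ ∧
        (B q).Γ.map (Matrix.GeneralLinearGroup.map ((B q).τ₁ : ↥(B q).E →+* ℂ)) =
          (arithmeticLevel (↥(maximalRealSubfield L)) L (IsCMField.complexConj L) 3 H
            (K.map (MulAut.conj (g q)).toMonoidHom)).map (Matrix.GeneralLinearGroup.map τ) ∧
        ∀ x : Ball, AlgPoints.map (L := ℂ) (ι' q) ((B q).unif ((T : Matrix (Fin 3) (Fin 3) ℂ) *ᵥ lift x)) = P x (g q) := by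
  classical
  -- per piece: the ball datum, with the field pin kept
  have hB : ∀ q, ∃ B : UnitaryBallUniformisationDatum 2 (E q),
      B.E = τ.fieldRange ∧ B.Hℂ = H.map τ ∧
        B.Γ.map (Matrix.GeneralLinearGroup.map (B.τ₁ : B.E →+* ℂ)) =
          (arithmeticLevel (↥(maximalRealSubfield L)) L (IsCMField.complexConj L) 3 H
            (K.map (MulAut.conj (g q)).toMonoidHom)).map (Matrix.GeneralLinearGroup.map τ) ∧
        ∀ z : Ball, B.unif ((T : Matrix (Fin 3) (Fin 3) ℂ) *ᵥ lift z) = (φ q).symm (Quotient.mk'' z) := by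
    intro q
    haveI := hopen q
    obtain ⟨u, hu1, hu2, hu3⟩ := hol (g q)
    -- the natural level `U(H)(L⁺) ∩ g_qKg_q⁻¹` is a congruence subgroup (compact open conjugate) and torsion-free
    have hcong : IsCongruenceSubgroup (cmConjRingHom L) H
        (arithmeticLevel (↥(maximalRealSubfield L)) L (IsCMField.complexConj L) 3 H
          (K.map (MulAut.conj (g q)).toMonoidHom)) :=
      isCongruenceSubgroup_arithmeticLevel_of_isOpen (isCompact_coe_map_conj hKc (g q)) (isOpen_coe_map_conj hKo (g q))
    exact exists_pieceBallDatum L H τ T hT hH hanis hpos hcong (htf (g q)) (ι q) (hE q) (φ q) u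
      (fun z => by rw [hu1 z, hφ q z]) hu2 hu3
  choose B hB using hB
  exact ⟨E, ι, hcol, B, fun q => ⟨(hB q).1, (hB q).2.1, (hB q).2.2.1, fun x => by rw [(hB q).2.2.2 x, hφ q x]⟩⟩

/-! ## 2. The pieces of the complex fibre of the record (one level), with the field pin -/

/-- **(F2c) `pieces` DERIVED at one level, with `(B q).E = τ(L)`.**  ★ `Record.exists_pieces` (same hypotheses, token for
token) with the conjunct `(B q).E = τ.fieldRange` prepended to its conclusion; proof = the ★ proof with §1 in place of ★
`exists_pieces_of_components`.
[cite: Deligne1979ShimuraVarieties, §2.1.2–2.1.3 and 2.2.5] [cite: Milne2005ShimuraVarieties, Lemma 5.13 p. 57]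
[cite: Liu2002, Prop. 3.1.23 and Prop. 4.3.38] [cite: ConradAdelicPoints2012, Prop. 2.1 and Prop. 3.1] -/
theorem Record.exists_pieces_fieldRange
    (hH : ∀ i j, cmConjRingHom L (H i j) = H j i)
    (hanis : ∀ v : Fin 3 → L, hermForm (cmConjRingHom L) H v v = 0 → v = 0)
    (hpos : ∀ τ' : L →+* ℂ, InfinitePlace.mk τ' ≠ InfinitePlace.mk τ → (H.map τ').PosDef)
    (hKc : IsCompact (K : Set (finAdelic (↥(maximalRealSubfield L)) L (IsCMField.complexConj L) 3 H)))
    (hKo : IsOpen (K : Set (finAdelic (↥(maximalRealSubfield L)) L (IsCMField.complexConj L) 3 H)))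
    (htf : ∀ g : finAdelic (↥(maximalRealSubfield L)) L (IsCMField.complexConj L) 3 H,
      ∀ γ ∈ arithmeticLevel (↥(maximalRealSubfield L)) L (IsCMField.complexConj L) 3 H
        (K.map (MulAut.conj g).toMonoidHom), IsOfFinOrder γ → γ = 1)
    (R : Record L H τ T hT K) :
    letI : Algebra L ℂ := τ.toAlgebra
    ∃ (g : orbitRel.Quotient (rational (↥(maximalRealSubfield L)) L (IsCMField.complexConj L) 3 H)
          (CosetSpace (rationalToFinAdelic (↥(maximalRealSubfield L)) L (IsCMField.complexConj L) 3 H) K) →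
        finAdelic (↥(maximalRealSubfield L)) L (IsCMField.complexConj L) 3 H)
      (_ : ∀ q, Quotient.mk'' (CosetSpace.pt (rationalToFinAdelic _ L _ 3 H) K (g q)) = q)
      (X : orbitRel.Quotient (rational (↥(maximalRealSubfield L)) L (IsCMField.complexConj L) 3 H)
          (CosetSpace (rationalToFinAdelic (↥(maximalRealSubfield L)) L (IsCMField.complexConj L) 3 H) K) →
        SchemeOver ℂ)
      (ι : ∀ q, X q ⟶ (baseChangeHom τ).obj R.M)
      (_ : IsColimit (Cofan.mk ((baseChangeHom τ).obj R.M) ι))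
      (B : ∀ q, UnitaryBallUniformisationDatum 2 (X q)),
      ∀ q, (B q).E = τ.fieldRange ∧ (B q).Hℂ = H.map τ ∧
        (B q).Γ.map (Matrix.GeneralLinearGroup.map ((B q).τ₁ : ↥(B q).E →+* ℂ)) =
          (arithmeticLevel (↥(maximalRealSubfield L)) L (IsCMField.complexConj L) 3 H
            (K.map (MulAut.conj (g q)).toMonoidHom)).map (Matrix.GeneralLinearGroup.map τ) ∧
        ∀ x : Ball, AlgPoints.map (ι q) ((B q).unif ((T : Matrix (Fin 3) (Fin 3) ℂ) *ᵥ BallModel.lift x)) =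
          AlgPoints.baseChangeEquiv τ R.M (R.pts.symm (ShimuraSet.mk L H τ T hT K x (g q))) := by
  classical
  letI : Algebra L ℂ := τ.toAlgebra
  -- (F1) under base change: the complex fibre is a smooth projective model
  haveI hsm : SmoothOfRelativeDimension 2 ((baseChangeHom τ).obj R.M).hom := by
    haveI := R.smooth
    exact Literature.AlgebraicGeometry.HodgeTheory.smoothOfRelativeDimension_baseChangeHom_hom τ 2 R.M
  have hpr : IsProjectiveOver ((baseChangeHom τ).obj R.M) := R.projective.baseChange_obj ℂ
  -- (F2a) moved to the complex fibre: `e⁻¹ [z, aK] = baseChangeEquiv τ M (pts⁻¹ [z, aK])`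
  let b : ComplexPoints R.M ≃ₜ ComplexPoints ((baseChangeHom τ).obj R.M) :=
    Homeomorph.mk (AlgPoints.baseChangeEquiv τ R.M) (AlgPoints.continuous_baseChangeEquiv τ R.M)
      (AlgPoints.continuous_baseChangeEquiv_symm τ R.M)
  let e : ComplexPoints ((baseChangeHom τ).obj R.M) ≃ₜ ShimuraSet L H τ T hT K := b.symm.trans R.pts
  have he : ∀ (z : Ball) (a : finAdelic (↥(maximalRealSubfield L)) L (IsCMField.complexConj L) 3 H),
      e.symm (ShimuraSet.mk L H τ T hT K z a) =
        AlgPoints.baseChangeEquiv τ R.M (R.pts.symm (ShimuraSet.mk L H τ T hT K z a)) := fun _ _ => rfl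
  -- representatives of `Ξ_K`
  have hrep : ∀ q : orbitRel.Quotient (rational (↥(maximalRealSubfield L)) L (IsCMField.complexConj L) 3 H)
      (CosetSpace (rationalToFinAdelic (↥(maximalRealSubfield L)) L (IsCMField.complexConj L) 3 H) K),
      ∃ a : finAdelic (↥(maximalRealSubfield L)) L (IsCMField.complexConj L) 3 H,
        Quotient.mk'' (CosetSpace.pt (rationalToFinAdelic _ L _ 3 H) K a) = q := by
    intro q
    induction q using Quotient.inductionOn' with
    | h p =>
      obtain ⟨a, rfl⟩ := CosetSpace.pt_surjective (rationalToFinAdelic _ L _ 3 H) K p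
      exact ⟨a, rfl⟩
  choose g hg using hrep
  -- (T2) with the scheme-level colimit
  obtain ⟨E, ι, φ, hE, hopen, -, -, -, hφ, -, ⟨hcol⟩⟩ :=
    Literature.AlgebraicGeometry.ShimuraVarieties.Deligne1979.exists_components_homeomorph_ballQuotient_isColimit
      L H τ T hT K (d := 2) hpr hKo e g hg
  -- §1 with `P z a := e⁻¹ [z, aK]`
  obtain ⟨X', ι', hcol', B, hB⟩ := exists_pieces_of_components_fieldRange L H τ T hT K hH hanis hpos hKc hKo htf
    (fun z a => e.symm (ShimuraSet.mk L H τ T hT K z a))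
    (fun a => by
      obtain ⟨u, hu1, hu2, hu3⟩ := R.hol a
      exact ⟨u, fun x => by rw [hu1 x, he], hu2, hu3⟩)
    g E ι φ hE hopen hφ hcol
  exact ⟨g, hg, X', ι', hcol', B, fun q => ⟨(hB q).1, (hB q).2.1, (hB q).2.2.1, fun x => by rw [(hB q).2.2.2 x, he]⟩⟩

/-! ## 3. The pieces at every small level of the system, with the field pin -/

/-- **(F2c) `pieces` DERIVED at every small level `K ≤ K₀`, with `(B q).E = τ(L)`.**  ★ `RecordSystem.exists_pieces`
(same hypotheses, token for token) with the conjunct `(B q).E = τ.fieldRange` prepended; the ★ three-line wrapper over §2.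
[cite: Deligne1979ShimuraVarieties, §2.1.2–2.1.4 and 2.2.5] [cite: Milne2005ShimuraVarieties, Lemma 5.13 p. 57 and Def. 12.10 p. 115] -/
theorem RecordSystem.exists_pieces_fieldRange
    {K₀ : C5.OpenCompactSubgroup ↥(finAdelic (↥(maximalRealSubfield L)) L (IsCMField.complexConj L) 3 H)}
    (hH : ∀ i j, cmConjRingHom L (H i j) = H j i)
    (hanis : ∀ v : Fin 3 → L, hermForm (cmConjRingHom L) H v v = 0 → v = 0)
    (hpos : ∀ τ' : L →+* ℂ, InfinitePlace.mk τ' ≠ InfinitePlace.mk τ → (H.map τ').PosDef)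
    (htf : ∀ g : finAdelic (↥(maximalRealSubfield L)) L (IsCMField.complexConj L) 3 H,
      ∀ γ ∈ arithmeticLevel (↥(maximalRealSubfield L)) L (IsCMField.complexConj L) 3 H
        (K₀.1.map (MulAut.conj g).toMonoidHom), IsOfFinOrder γ → γ = 1)
    (S : RecordSystem L H τ T hT K₀) (K : C5.SmallLevel K₀) :
    letI : Algebra L ℂ := τ.toAlgebra
    ∃ (g : orbitRel.Quotient (rational (↥(maximalRealSubfield L)) L (IsCMField.complexConj L) 3 H)
          (CosetSpace (rationalToFinAdelic (↥(maximalRealSubfield L)) L (IsCMField.complexConj L) 3 H) K.1.1) →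
        finAdelic (↥(maximalRealSubfield L)) L (IsCMField.complexConj L) 3 H)
      (_ : ∀ q, Quotient.mk'' (CosetSpace.pt (rationalToFinAdelic _ L _ 3 H) K.1.1 (g q)) = q)
      (X : orbitRel.Quotient (rational (↥(maximalRealSubfield L)) L (IsCMField.complexConj L) 3 H)
          (CosetSpace (rationalToFinAdelic (↥(maximalRealSubfield L)) L (IsCMField.complexConj L) 3 H) K.1.1) →
        SchemeOver ℂ)
      (ι : ∀ q, X q ⟶ (baseChangeHom τ).obj (S.M.obj K))
      (_ : IsColimit (Cofan.mk ((baseChangeHom τ).obj (S.M.obj K)) ι))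
      (B : ∀ q, UnitaryBallUniformisationDatum 2 (X q)),
      ∀ q, (B q).E = τ.fieldRange ∧ (B q).Hℂ = H.map τ ∧
        (B q).Γ.map (Matrix.GeneralLinearGroup.map ((B q).τ₁ : ↥(B q).E →+* ℂ)) =
          (arithmeticLevel (↥(maximalRealSubfield L)) L (IsCMField.complexConj L) 3 H
            (K.1.1.map (MulAut.conj (g q)).toMonoidHom)).map (Matrix.GeneralLinearGroup.map τ) ∧
        ∀ x : Ball, AlgPoints.map (ι q) ((B q).unif ((T : Matrix (Fin 3) (Fin 3) ℂ) *ᵥ BallModel.lift x)) =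
          AlgPoints.baseChangeEquiv τ (S.M.obj K) ((S.pts K).symm (ShimuraSet.mk L H τ T hT K.1.1 x (g q))) :=
  Record.exists_pieces_fieldRange L H τ T hT K.1.1 hH hanis hpos K.1.2.2 K.1.2.1
    (torsionFree_arithmeticLevel_conj_of_le K.2 htf)
    (S.record L H τ T hT K)

/-! ## 4. Read-outs over the pinned field (def-free; `e : L ≃+* ↥D.E` over `τ` is the consumer's) -/

section ReadOut

variable {L}
variable {p : ℕ} {X : SchemeOver ℂ} (D : UnitaryBallUniformisationDatum p X)

omit [NumberField L] [IsCMField L] in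
/-- **A ring isomorphism `L ≃+* D.E` over `τ` exists as soon as `D.E = τ(L)`** — the consumer's `e` (for instance
`τ.rangeRestrictFieldEquiv.trans (RingEquiv.subfieldCongr h.symm)`; stated as an existence so that this file declares no
`def`). [folklore] -/
theorem ballDatum_exists_ringEquiv_coe_eq_of_E_eq
    (h : D.E = τ.fieldRange) : ∃ e : L ≃+* ↥D.E, ∀ x : L, ((e x : ↥D.E) : ℂ) = τ x :=
  ⟨τ.rangeRestrictFieldEquiv.trans (RingEquiv.subfieldCongr h.symm), fun _ => rfl⟩

variable (e : L ≃+* ↥D.E) (he : ∀ x : L, ((e x : ↥D.E) : ℂ) = τ x)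

omit [NumberField L] [IsCMField L] in
include he in
/-- `D.E.subtype ∘ e = τ` as ring homomorphisms. [folklore] -/
private theorem ballDatum_subtype_comp_ringEquiv_eq
    : (D.E.subtype).comp e.toRingHom = τ :=
  RingHom.ext fun x => he x

omit [NumberField L] [IsCMField L] in
include he in
/-- **Gram matrix over the pinned field**: if `D.Hℂ = Hm^τ` then `D.H = Hm.map e` (injectivity of `D.E ⊆ ℂ` entrywise).
[folklore] -/
theorem ballDatum_H_eq_map_ringEquiv_of_Hℂ_eq
    {Hm : Matrix (Fin (p + 1)) (Fin (p + 1)) L} (hH : D.Hℂ = Hm.map τ) : D.H = Hm.map e.toRingHom := by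
  ext i j
  have h := congrFun (congrFun hH i) j
  change (D.H i j : ℂ) = τ (Hm i j) at h
  rw [h]
  exact (he (Hm i j)).symm

omit [NumberField L] [IsCMField L] in
include he in
/-- `(Γ′.map (GL.map e)).map (GL.map D.E.subtype) = Γ′.map (GL.map τ)`: the transported group, read in `GL(ℂ)`, is `τ(Γ′)`.
[folklore] -/
private theorem ballDatum_map_ringEquiv_map_subtype_subgroup
    {m : Type*} [Fintype m] [DecidableEq m] (Γ' : Subgroup (GL m L)) :
    (Γ'.map (Matrix.GeneralLinearGroup.map e.toRingHom)).map
        (Matrix.GeneralLinearGroup.map (D.E.subtype : ↥D.E →+* ℂ)) =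
      Γ'.map (Matrix.GeneralLinearGroup.map τ) := by
  rw [Subgroup.map_map, ← Matrix.GeneralLinearGroup.map_comp,
    ballDatum_subtype_comp_ringEquiv_eq τ D e he]

omit [NumberField L] [IsCMField L] in
include he in
/-- **Group over the pinned field**: if the `GL(ℂ)`-images agree, `τ₁(D.Γ) = τ(Γ′)`, then `D.Γ = Γ′.map (GL.map e)`
(`GL.map D.E.subtype` is injective, so `Subgroup.map` along it is injective). [folklore] -/
theorem ballDatum_Γ_eq_map_ringEquiv_of_map_eq
    {Γ' : Subgroup (GL (Fin (p + 1)) L)}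
    (hΓ : D.Γ.map (Matrix.GeneralLinearGroup.map (D.τ₁ : ↥D.E →+* ℂ)) = Γ'.map (Matrix.GeneralLinearGroup.map τ)) :
    D.Γ = Γ'.map (Matrix.GeneralLinearGroup.map e.toRingHom) := by
  apply Subgroup.map_injective
    (generalLinearGroup_map_injective (D.E.subtype : ↥D.E →+* ℂ) Subtype.val_injective)
  change D.Γ.map (Matrix.GeneralLinearGroup.map (D.τ₁ : ↥D.E →+* ℂ)) = _
  rw [hΓ,
    ballDatum_map_ringEquiv_map_subtype_subgroup τ D e he]

end ReadOut

end Summit.HodgeConjecture.CorCM.HComp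

end
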